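import Summits.CriticalPhenomena.CardyFormulaZ2.Theorems.CardyComplexConeParafermionToSLESixFamiliesDiamondTouchLowerHalfPlane
import Literature.Probability.Percolation.LatticeSymmetry
import HarnessLib

/-!
# Transport of the half-plane gluing events along lattice automorphisms
# (line `potential-darboux-picard-diamond`, S3 (c) `freeTouchLower_of_diagArmLower`, part 1b)

Crux `ParafermionToSLESixFamilies` (stmt-CriticalPhenomena-11389), line `potential-darboux-picard-diamond`, conditional
helper `freeTouchLower_of_diagArmLower` of S3. Companion of `…DiamondTouchLowerHalfPlane.lean` (same abstract integer
coordinates `X, Y` of `ℤ²`, same local notation). The probabilistic constants of the gluing (`real_arm_glue_ge`, the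
RSW box bounds) are produced by the tree's toolkit ONCE, for the diagonal coordinates `(col, hgtOf)`; the four side frames
of a diamond discretisation are images of that frame under lattice automorphisms `φ` with `X' ∘ φ = X + s`,
`Y' ∘ φ = Y + t`, under which `P_p` is invariant (`bondPercolation_real_image`, `bondPercolation_real_preimage_relabel_iso`).
This file carries the events across: images of coordinate boxes, levels and half-boxes (`image_box`, `image_armbox`, …),
equality of the probabilities of corresponding box crossings (`real_LR_transport`, `real_TB_transport`) and arm events
(`real_arm_transport`), and the transported Harris–FKG gluing bound with constants independent of the frame
(`real_arm_glue_transport`).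
-/

noncomputable section

namespace Summit.CriticalPhenomena.CardyFormulaZ2.Cruxes.ParafermionToSLESixFamilies.PotentialDarbouxPicardDiamond

namespace TouchLower

open MeasureTheory Set
open Literature.Probability.LatticeModels Literature.Probability.Percolation
open Literature.Probability.Percolation.HalfPlaneArm

variable {X Y : Site 2 → ℤ}

local notation3 "ν[" b ", " v "]" => max |X v - X b| (Y v - Y b)
local notation3 "box[" A₁ ", " A₂ ", " B₁ ", " B₂ "]" =>
  {v : Site 2 | A₁ ≤ X v ∧ X v ≤ A₂ ∧ B₁ ≤ Y v ∧ Y v ≤ B₂}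
local notation3 "LR[" A₁ ", " A₂ ", " B₁ ", " B₂ "]" =>
  openCrossing box[A₁, A₂, B₁, B₂] {v : Site 2 | X v = A₁} {v : Site 2 | X v = A₂}
local notation3 "TB[" A₁ ", " A₂ ", " B₁ ", " B₂ "]" =>
  openCrossing box[A₁, A₂, B₁, B₂] {v : Site 2 | Y v = B₁} {v : Site 2 | Y v = B₂}
local notation3 "LRf[" A ", " B ", " w ", " h "]" =>
  openCrossing {v : Site 2 | A - 2 ≤ X v ∧ X v ≤ A + w + 2 ∧ B ≤ Y v ∧ Y v ≤ B + h}
    {v : Site 2 | X v ≤ A} {v : Site 2 | A + w ≤ X v}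
local notation3 "TBf[" A ", " B ", " w ", " h "]" =>
  openCrossing {v : Site 2 | A ≤ X v ∧ X v ≤ A + w ∧ B - 2 ≤ Y v ∧ Y v ≤ B + h + 2}
    {v : Site 2 | Y v ≤ B} {v : Site 2 | B + h ≤ Y v}
local notation3 "Ubox[" b ", " a "]" => box[X b - 2 * a, X b + 2 * a, 0, Y b + 2 * a]
local notation3 "U[" b ", " a "]" =>
  TB[X b + a, X b + 2 * a, 0, Y b + 2 * a] ∩ LR[X b - 2 * a, X b + 2 * a, Y b + a, Y b + 2 * a] ∩
    TB[X b - 2 * a, X b - a, 0, Y b + 2 * a]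
local notation3 "μ[" p "]" => bondPercolation (zdGraph 2) p
local notation3 "RSW_LR[" p "]" => ∀ k : ℕ, 2 ≤ k → ∃ c : ℝ, 0 < c ∧ ∃ m₀ : ℕ, ∀ m : ℕ, m₀ ≤ m →
  ∀ A B : ℤ, c ≤ (bondPercolation (zdGraph 2) p).real LRf[A, B, (k : ℤ) * m, (m : ℤ)]
local notation3 "RSW_TB[" p "]" => ∀ k : ℕ, 2 ≤ k → ∃ c : ℝ, 0 < c ∧ ∃ m₀ : ℕ, ∀ m : ℕ, m₀ ≤ m →
  ∀ A B : ℤ, c ≤ (bondPercolation (zdGraph 2) p).real TBf[A, B, (m : ℤ), (k : ℤ) * m]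
local notation3 "armbox[" x ", " n "]" => {v : Site 2 | 0 ≤ Y v ∧ ν[x, v] ≤ n}
local notation3 "arm[" x ", " n "]" => openCrossing armbox[x, n] {x} {v : Site 2 | ν[x, v] = n}

/-! ## Transport along a lattice automorphism intertwining two coordinate pairs -/

section Transport

variable {X' Y' : Site 2 → ℤ} (φ : zdGraph 2 ≃g zdGraph 2) {s t : ℤ}

/-- Membership in the image of a set under a lattice automorphism. -/
theorem mem_image_iso (S : Set (Site 2)) (v : Site 2) : v ∈ (φ : Site 2 → Site 2) '' S ↔ φ.symm v ∈ S := by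
  rw [← RelIso.coe_fn_toEquiv, Set.mem_image_equiv]
  rfl

/-- The old coordinate of a preimage. -/
theorem coord_symm {Z Z' : Site 2 → ℤ} {r : ℤ} (hφ : ∀ v, Z' (φ v) = Z v + r) (v : Site 2) : Z (φ.symm v) = Z' v - r := by
  have := hφ (φ.symm v)
  rw [RelIso.apply_symm_apply] at this
  omega

variable (hXφ : ∀ v, X' (φ v) = X v + s) (hYφ : ∀ v, Y' (φ v) = Y v + t)

include hXφ hYφ in
/-- **The image of a coordinate box** is the shifted box of the new coordinates. -/
theorem image_box (A₁ A₂ B₁ B₂ : ℤ) : (φ : Site 2 → Site 2) '' box[A₁, A₂, B₁, B₂] =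
    {v : Site 2 | A₁ + s ≤ X' v ∧ X' v ≤ A₂ + s ∧ B₁ + t ≤ Y' v ∧ Y' v ≤ B₂ + t} := by
  have hXs := coord_symm φ hXφ
  have hYs := coord_symm φ hYφ
  ext v; rw [mem_image_iso]; simp only [mem_setOf_eq, hXs, hYs]; omega

include hXφ in
/-- The image of a level set of the first coordinate. -/
theorem image_Xeq (A : ℤ) : (φ : Site 2 → Site 2) '' {v : Site 2 | X v = A} = {v : Site 2 | X' v = A + s} := by
  have hXs := coord_symm φ hXφ
  ext v; rw [mem_image_iso]; simp only [mem_setOf_eq, hXs]; omega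

include hYφ in
/-- The image of a level set of the second coordinate. -/
theorem image_Yeq (B : ℤ) : (φ : Site 2 → Site 2) '' {v : Site 2 | Y v = B} = {v : Site 2 | Y' v = B + t} := by
  have hYs := coord_symm φ hYφ
  ext v; rw [mem_image_iso]; simp only [mem_setOf_eq, hYs]; omega

include hXφ hYφ in
/-- **Corresponding left–right box crossings are equiprobable.** -/
theorem real_LR_transport (p : unitInterval) (A₁ A₂ B₁ B₂ : ℤ) :
    (μ[p]).real (openCrossing {v : Site 2 | A₁ ≤ X' v ∧ X' v ≤ A₂ ∧ B₁ ≤ Y' v ∧ Y' v ≤ B₂} {v : Site 2 | X' v = A₁}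
        {v : Site 2 | X' v = A₂}) = (μ[p]).real LR[A₁ - s, A₂ - s, B₁ - t, B₂ - t] := by
  rw [← bondPercolation_real_image φ p box[A₁ - s, A₂ - s, B₁ - t, B₂ - t], image_box φ hXφ hYφ, image_Xeq φ hXφ,
    image_Xeq φ hXφ]
  simp only [sub_add_cancel]

include hXφ hYφ in
/-- **Corresponding top–bottom box crossings are equiprobable.** -/
theorem real_TB_transport (p : unitInterval) (A₁ A₂ B₁ B₂ : ℤ) :
    (μ[p]).real (openCrossing {v : Site 2 | A₁ ≤ X' v ∧ X' v ≤ A₂ ∧ B₁ ≤ Y' v ∧ Y' v ≤ B₂} {v : Site 2 | Y' v = B₁}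
        {v : Site 2 | Y' v = B₂}) = (μ[p]).real TB[A₁ - s, A₂ - s, B₁ - t, B₂ - t] := by
  rw [← bondPercolation_real_image φ p box[A₁ - s, A₂ - s, B₁ - t, B₂ - t], image_box φ hXφ hYφ, image_Yeq φ hYφ,
    image_Yeq φ hYφ]
  simp only [sub_add_cancel]

/-! ### Based events: the second coordinate preserved exactly -/

variable (hYφ₀ : ∀ v, Y' (φ v) = Y v)

include hXφ hYφ₀ in
/-- The image of the half-box of the arm. -/
theorem image_armbox (b : Site 2) (n : ℤ) : (φ : Site 2 → Site 2) '' armbox[b, n] =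
    {v : Site 2 | 0 ≤ Y' v ∧ max |X' v - X' (φ b)| (Y' v - Y' (φ b)) ≤ n} := by
  have hYφ' : ∀ v, Y' (φ v) = Y v + 0 := fun v => by rw [hYφ₀, add_zero]
  have hXs := coord_symm φ hXφ
  have hYs := coord_symm φ hYφ'
  ext v
  rw [mem_image_iso]
  simp only [mem_setOf_eq]
  rw [hXs, hYs, hXφ, hYφ₀, sub_zero, show X' v - s - X b = X' v - (X b + s) by ring]

include hXφ hYφ₀ in
/-- The image of a level set of the half-plane norm. -/
theorem image_level (b : Site 2) (n : ℤ) : (φ : Site 2 → Site 2) '' {v : Site 2 | ν[b, v] = n} =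
    {v : Site 2 | max |X' v - X' (φ b)| (Y' v - Y' (φ b)) = n} := by
  have hYφ' : ∀ v, Y' (φ v) = Y v + 0 := fun v => by rw [hYφ₀, add_zero]
  have hXs := coord_symm φ hXφ
  have hYs := coord_symm φ hYφ'
  ext v
  rw [mem_image_iso]
  simp only [mem_setOf_eq]
  rw [hXs, hYs, hXφ, hYφ₀, sub_zero, show X' v - s - X b = X' v - (X b + s) by ring]

include hXφ hYφ₀ in
/-- The image of a box described relative to the base point. -/
theorem image_box_based (b : Site 2) (a₁ a₂ c₁ c₂ : ℤ) :
    (φ : Site 2 → Site 2) '' box[X b + a₁, X b + a₂, c₁, Y b + c₂] =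
    {v : Site 2 | X' (φ b) + a₁ ≤ X' v ∧ X' v ≤ X' (φ b) + a₂ ∧ c₁ ≤ Y' v ∧ Y' v ≤ Y' (φ b) + c₂} := by
  have hYφ' : ∀ v, Y' (φ v) = Y v + 0 := fun v => by rw [hYφ₀, add_zero]
  rw [image_box φ hXφ hYφ']
  ext v; simp only [mem_setOf_eq, hXφ, hYφ₀]; omega

include hXφ in
/-- The image of a level set of the first coordinate, relative to the base point. -/
theorem image_Xeq_based (b : Site 2) (a : ℤ) :
    (φ : Site 2 → Site 2) '' {v : Site 2 | X v = X b + a} = {v : Site 2 | X' v = X' (φ b) + a} := by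
  rw [image_Xeq φ hXφ]
  ext v; simp only [mem_setOf_eq, hXφ]; omega

include hYφ₀ in
/-- The image of a level set of the second coordinate, relative to the base point. -/
theorem image_Yeq_based (b : Site 2) (c : ℤ) :
    (φ : Site 2 → Site 2) '' {v : Site 2 | Y v = Y b + c} = {v : Site 2 | Y' v = Y' (φ b) + c} := by
  have hYφ' : ∀ v, Y' (φ v) = Y v + 0 := fun v => by rw [hYφ₀, add_zero]
  rw [image_Yeq φ hYφ']
  ext v; simp only [mem_setOf_eq, hYφ₀]; omega

include hYφ₀ in
/-- The image of the floor of the half-plane. -/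
theorem image_Yeq_zero : (φ : Site 2 → Site 2) '' {v : Site 2 | Y v = 0} = {v : Site 2 | Y' v = 0} := by
  have hYφ' : ∀ v, Y' (φ v) = Y v + 0 := fun v => by rw [hYφ₀, add_zero]
  rw [image_Yeq φ hYφ', add_zero]

include hXφ hYφ₀ in
/-- **Transport of the arm event.** If the lattice automorphism `φ` shifts the first coordinate (`X' ∘ φ = X + s`) and
preserves the second (`Y' ∘ φ = Y`), the half-plane arm events in the two coordinate pairs correspond under `φ` and have
the same probability. -/
theorem real_arm_transport (p : unitInterval) (b : Site 2) (n : ℤ) :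
    (μ[p]).real (openCrossing {v : Site 2 | 0 ≤ Y' v ∧ max |X' v - X' (φ b)| (Y' v - Y' (φ b)) ≤ n} {φ b}
        {v : Site 2 | max |X' v - X' (φ b)| (Y' v - Y' (φ b)) = n}) = (μ[p]).real arm[b, n] := by
  rw [← bondPercolation_real_image φ p armbox[b, n] {b} {v : Site 2 | ν[b, v] = n}, image_singleton,
    image_armbox φ hXφ hYφ₀, image_level φ hXφ hYφ₀]

/-- Pull-back of an open crossing event of image sets along the relabelling (the tree's
`preimage_relabel_openCrossing`, for a graph automorphism). -/
theorem preimage_relabel_openCrossing_iso (S A B : Set (Site 2)) :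
    BondConfig.relabel (sym2Equiv φ.toEquiv) ⁻¹'
        openCrossing ((φ : Site 2 → Site 2) '' S) ((φ : Site 2 → Site 2) '' A) ((φ : Site 2 → Site 2) '' B) =
      openCrossing S A B := by
  rw [← RelIso.coe_fn_toEquiv]
  exact preimage_relabel_openCrossing φ.toEquiv S A B

variable (hX : ∀ u v, (zdGraph 2).Adj u v → X v ≤ X u + 1) (hY : ∀ u v, (zdGraph 2).Adj u v → Y v ≤ Y u + 1)
  (hInj : Function.Injective fun v : Site 2 => (X v, Y v))

include hX hY hInj in
/-- **Harris–FKG gluing of the arm, transported, with constants independent of the frame.** There are `c > 0` and `m₀`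
(those of `real_arm_glue_ge` for the coordinates `X, Y`) such that for EVERY coordinate pair `X', Y'` intertwined with
`X, Y` by a lattice automorphism `φ` (`X' ∘ φ = X + s`, `Y' ∘ φ = Y`), every base point `b` on the row `Y = 0`, every
`m ≥ m₀` and every increasing measurable event `R`:
`c · P(arm'[φ b, 2m]) · P(R) ≤ P(arm'[φ b, 2m] ∩ U'[φ b, m] ∩ TB'([X'(φ b) - m, X'(φ b) + m] × [0, 3m]) ∩ R)`,
the primed events being those of the coordinates `X', Y'`. -/
theorem real_arm_glue_transport (p : unitInterval) (rswLR : RSW_LR[p]) (rswTB : RSW_TB[p]) :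
    ∃ c : ℝ, 0 < c ∧ ∃ m₀ : ℕ, ∀ (X' Y' : Site 2 → ℤ) (φ : zdGraph 2 ≃g zdGraph 2) (s : ℤ),
      (∀ v, X' (φ v) = X v + s) → (∀ v, Y' (φ v) = Y v) → ∀ (b : Site 2) (m : ℤ), Y b = 0 → (m₀ : ℤ) ≤ m →
      ∀ R : Set (BondConfig (Site 2)), IsUpperSet R → MeasurableSet R →
        c * (μ[p]).real (openCrossing {v : Site 2 | 0 ≤ Y' v ∧ max |X' v - X' (φ b)| (Y' v - Y' (φ b)) ≤ 2 * m} {φ b}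
            {v : Site 2 | max |X' v - X' (φ b)| (Y' v - Y' (φ b)) = 2 * m}) * (μ[p]).real R ≤
        (μ[p]).real
          (openCrossing {v : Site 2 | 0 ≤ Y' v ∧ max |X' v - X' (φ b)| (Y' v - Y' (φ b)) ≤ 2 * m} {φ b}
              {v : Site 2 | max |X' v - X' (φ b)| (Y' v - Y' (φ b)) = 2 * m} ∩
            (openCrossing {v : Site 2 | X' (φ b) + m ≤ X' v ∧ X' v ≤ X' (φ b) + 2 * m ∧ 0 ≤ Y' v ∧ Y' v ≤ Y' (φ b) + 2 * m}
                {v : Site 2 | Y' v = 0} {v : Site 2 | Y' v = Y' (φ b) + 2 * m} ∩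
              openCrossing {v : Site 2 | X' (φ b) - 2 * m ≤ X' v ∧ X' v ≤ X' (φ b) + 2 * m ∧ Y' (φ b) + m ≤ Y' v ∧
                  Y' v ≤ Y' (φ b) + 2 * m} {v : Site 2 | X' v = X' (φ b) - 2 * m} {v : Site 2 | X' v = X' (φ b) + 2 * m} ∩
              openCrossing {v : Site 2 | X' (φ b) - 2 * m ≤ X' v ∧ X' v ≤ X' (φ b) - m ∧ 0 ≤ Y' v ∧ Y' v ≤ Y' (φ b) + 2 * m}
                {v : Site 2 | Y' v = 0} {v : Site 2 | Y' v = Y' (φ b) + 2 * m}) ∩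
            openCrossing {v : Site 2 | X' (φ b) - m ≤ X' v ∧ X' v ≤ X' (φ b) + m ∧ 0 ≤ Y' v ∧ Y' v ≤ 3 * m}
              {v : Site 2 | Y' v = 0} {v : Site 2 | Y' v = 3 * m} ∩ R) := by
  obtain ⟨c, hc, m₀, h⟩ := real_arm_glue_ge hX hY hInj p rswLR rswTB
  refine ⟨c, hc, m₀, fun X' Y' φ s hXφ hYφ₀ b m hb hm R hR hRm => ?_⟩
  set ρ := BondConfig.relabel (sym2Equiv φ.toEquiv) with hρ
  have key := h b m hb hm (ρ ⁻¹' R) (hR.preimage_relabel _) (ρ.measurable hRm)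
  rw [bondPercolation_real_preimage_relabel_iso φ p R, ← real_arm_transport φ hXφ hYφ₀ p b (2 * m)] at key
  refine key.trans (le_of_eq ?_)
  conv_rhs => rw [← bondPercolation_real_preimage_relabel_iso φ p]
  congr 1
  simp only [Set.preimage_inter]
  have hYφ' : ∀ v, Y' (φ v) = Y v + 0 := fun v => by rw [hYφ₀, add_zero]
  -- identify the five pulled-back crossing events
  have eA : ρ ⁻¹' openCrossing {v : Site 2 | 0 ≤ Y' v ∧ max |X' v - X' (φ b)| (Y' v - Y' (φ b)) ≤ 2 * m} {φ b}
      {v : Site 2 | max |X' v - X' (φ b)| (Y' v - Y' (φ b)) = 2 * m} = arm[b, 2 * m] := by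
    rw [← image_armbox φ hXφ hYφ₀, ← image_level φ hXφ hYφ₀, ← image_singleton, hρ, preimage_relabel_openCrossing_iso]
  have ebox : ∀ a₁ a₂ C₁ C₂ : ℤ, (φ : Site 2 → Site 2) '' box[X b + a₁, X b + a₂, C₁, C₂] =
      {v : Site 2 | X' (φ b) + a₁ ≤ X' v ∧ X' v ≤ X' (φ b) + a₂ ∧ C₁ ≤ Y' v ∧ Y' v ≤ C₂} := by
    intro a₁ a₂ C₁ C₂
    rw [image_box φ hXφ hYφ']
    ext v; simp only [mem_setOf_eq, hXφ]; omega
  have eY : ∀ C : ℤ, (φ : Site 2 → Site 2) '' {v : Site 2 | Y v = C} = {v : Site 2 | Y' v = C} := by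
    intro C; rw [image_Yeq φ hYφ', add_zero]
  have eB : ∀ a₁ a₂ C : ℤ, ρ ⁻¹' openCrossing
      {v : Site 2 | X' (φ b) + a₁ ≤ X' v ∧ X' v ≤ X' (φ b) + a₂ ∧ 0 ≤ Y' v ∧ Y' v ≤ C}
      {v : Site 2 | Y' v = 0} {v : Site 2 | Y' v = C} = TB[X b + a₁, X b + a₂, 0, C] := by
    intro a₁ a₂ C
    rw [← ebox, ← eY 0, ← eY C, hρ, preimage_relabel_openCrossing_iso]
  have eC : ∀ a₁ a₂ C₁ C₂ : ℤ, ρ ⁻¹' openCrossing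
      {v : Site 2 | X' (φ b) + a₁ ≤ X' v ∧ X' v ≤ X' (φ b) + a₂ ∧ C₁ ≤ Y' v ∧ Y' v ≤ C₂}
      {v : Site 2 | X' v = X' (φ b) + a₁} {v : Site 2 | X' v = X' (φ b) + a₂} = LR[X b + a₁, X b + a₂, C₁, C₂] := by
    intro a₁ a₂ C₁ C₂
    rw [← ebox, ← image_Xeq_based φ hXφ, ← image_Xeq_based φ hXφ, hρ, preimage_relabel_openCrossing_iso]
  rw [eA]
  simp only [sub_eq_add_neg]
  rw [eB, eB, eC, eB, hYφ₀ b, hb]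

end Transport

end TouchLower

open Literature.Probability.LatticeModels Literature.Probability.Percolation in
/-- **Registered form of `TouchLower.real_LR_transport`** (helper of `freeTouchLower_of_diagArmLower`): along a lattice
automorphism `φ` with `X' ∘ φ = X + s`, `Y' ∘ φ = Y + t`, corresponding left–right box crossings are equiprobable. -/
theorem touchLower_real_LR_transport : ∀ (X Y X' Y' : Site 2 → ℤ) (φ : zdGraph 2 ≃g zdGraph 2) (s t : ℤ), (∀ v : Site 2, X' (φ v) = X v + s) → (∀ v : Site 2, Y' (φ v) = Y v + t) → ∀ (p : unitInterval) (A₁ A₂ B₁ B₂ : ℤ), (bondPercolation (zdGraph 2) p).real (openCrossing {v : Site 2 | A₁ ≤ X' v ∧ X' v ≤ A₂ ∧ B₁ ≤ Y' v ∧ Y' v ≤ B₂} {v : Site 2 | X' v = A₁} {v : Site 2 | X' v = A₂}) = (bondPercolation (zdGraph 2) p).real (openCrossing {v : Site 2 | A₁ - s ≤ X v ∧ X v ≤ A₂ - s ∧ B₁ - t ≤ Y v ∧ Y v ≤ B₂ - t} {v : Site 2 | X v = A₁ - s} {v : Site 2 | X v = A₂ - s}) :=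
  fun _ _ _ _ φ _ _ hXφ hYφ p A₁ A₂ B₁ B₂ => TouchLower.real_LR_transport φ hXφ hYφ p A₁ A₂ B₁ B₂

end Summit.CriticalPhenomena.CardyFormulaZ2.Cruxes.ParafermionToSLESixFamilies.PotentialDarbouxPicardDiamond

end
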